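import Summits.Ventures.LatticeQCDFlow.Exactness.Phi4HMCOneStepCSD
import HarnessLib

/-!
# The N-step HMC floor for the magnetisation, modulo the equilibrium total-momentum profile: `τ_int,traj(f(M)) ≥ 2 Var(f)/(V T² m̄) − ½`

HONEST FRAMING: exact (Metropolis-corrected) sampling algorithms for lattice gauge theory;
figures of merit are autocorrelation/cost numbers at stated couplings and volumes; no
continuum-physics claim.  (SCALAR calibration rung S0-A: not a gauge result.)

Venture `LatticeQCDFlow` (cell pub-lqcd), topic `Exactness`; FANOUT row 2 (`s0-phi4`, HMC arm).
NEW WORK of the cell, composing `Phi4HMCOneStepCSD` (the total-momentum path formula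
`M(q_N) − M(q_0) = (δ/2) Σ_{k<N} (P_k + P_{k+1})`) with `Phi4HMCCarreDuChamp`
(`τ_int ≥ 2 Var(f)/⟨(Δf)²⟩_acc − ½`).  `Phi4HMCOneStepCSD` left the trajectory of `N ≥ 2` steps NOT
CLAIMED because the intermediate total momenta are not controlled by the endpoint identity.  Here the
obstruction is isolated into ONE family of equilibrium quantities, the MOMENTUM PROFILE
`I_k = ∫∫ P((L^k z).2)² e^{−H(z)} dz` (`L` one qpq step, `P(p) = Σ_x p_x`): the mean squared total
momentum `k` integrator steps into a trajectory started in equilibrium.  For the exact Hamiltonian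
flow, or any integrator preserving `e^{−H}`, `I_k = V Z_p Z` for every `k`; for leapfrog `I_0 = V Z_p Z`
(`HMCMomentumMoments`) and `I_k` is finite for every `k` (polynomial growth, below) — its size is an
integrator-quality diagnostic, not a number claimed here.  Nothing is cited as a fact.

## What is proved (`Λ = Fin (n+1)`, `V = n+1`, `T = Nδ`)

* `measurable_leapfrogQPQ`, `integrable_totalSq_iterate_mul_exp_neg` — `P((L^k z).2)² e^{−H}` is
  integrable for every `k` (coercive action; `Phi4LeapfrogGrowth.phaseSize_iterate_le`);
* `sq_sum_le_mul_sum_sq` — `(Σ_{k<N} a_k)² ≤ N Σ_{k<N} a_k²`;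
* **`hmc_traj_msd_le`** — for every `f` with `|f ψ − f φ| ≤ |Σψ − Σφ|` and every profile bound
  `I_k ≤ m_k · V Z_p Z` (`k ≤ N`):
  `∫∫ a (f((Ψ_N z).1) − f(z.1))² e^{−H} ≤ (δ² N V/2) (Σ_{k<N} (m_k + m_{k+1})) · Z_p Z`
  (`a ≤ 1`, Cauchy on the path formula);
* **`hmcPhi4_traj_tauInt_ge`** — `λ > 0`, any `J`, every `δ`, `N ≥ 1`, `f` bounded measurable and
  1-Lipschitz in `M`, `g = f − ⟨f⟩`, summable autocorrelations with `ρ_g(1) < 1`: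
  `τ_int,traj(f) ≥ 2 ⟨(f − ⟨f⟩)²⟩ / ((δ² N V/2) Σ_{k<N}(m_k + m_{k+1})) − ½`;
  **`hmcPhi4_traj_tauInt_ge_uniform`** — with a uniform profile bound `m_k ≤ m̄` (`k ≤ N`):
  `τ_int,traj(f) ≥ 2 ⟨(f − ⟨f⟩)²⟩ / (V (Nδ)² m̄) − ½`  — i.e. `≳ 2χ/(T² m̄)` for the (clipped)
  magnetisation.

Reading (no numerics implied): in trajectory units HMC cannot decorrelate the magnetisation faster than
`2χ/(T² m̄) − ½`, where `m̄` is the trajectory-averaged equilibrium mean squared total momentum per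
site (`= 1` for an exact or `e^{−H}`-preserving integrator; `1 + O(δ²)`-type for leapfrog is the
expectation, NOT claimed): at FIXED trajectory length `T` the floor diverges with `χ`
(`z_int,M ≥ γ/ν` per trajectory), and escaping it requires `T` to grow like `√χ` — the free-field
optimum `T ∼ ξ` of Kennedy–Pendleton (named only) is of this kind.  NOT CLAIMED: any value of `m_k`
for leapfrog beyond `m_0 = 1`; `ρ_g(1) < 1` / summability; the unclipped `M` (the `PolyObs` files give
it for `N = 1`; the same plumbing applies here and is left undone).
-/

namespace Summit.Ventures.LatticeQCDFlow.Exactness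

open Real MeasureTheory Filter Finset
open Summit.Ventures.LatticeQCDFlow.Scoring

section Trajectory

variable {n : ℕ}

/-- One qpq leapfrog step is measurable. -/
theorem measurable_leapfrogQPQ (J : Fin (n + 1) → Fin (n + 1) → ℝ) (lam δ : ℝ) :
    Measurable (leapfrogQPQ J lam δ) := by
  rw [leapfrogQPQ_eq_leapfrog, leapfrog, Equiv.Perm.coe_mul, Equiv.Perm.coe_mul]
  exact ((measurable_drift (measurable_addDrift (measurable_halfDrift δ))).comp
    (measurable_kick (measurable_kickIncrement J lam δ))).comp
    (measurable_drift (measurable_addDrift (measurable_halfDrift δ)))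

/-- **The momentum profile is finite**: `P((L^k z).2)² e^{−H(z)}` is integrable on phase space for
every `k` (coercive action): `P² ≤ V Σp² ≤ V s(L^k z) ≤ V C_k s(z)^{4^k}`. -/
theorem integrable_totalSq_iterate_mul_exp_neg {J : Fin (n + 1) → Fin (n + 1) → ℝ} {lam ε K : ℝ}
    (hε : 0 < ε) (hS : ∀ φ : Fin (n + 1) → ℝ, ε * ∑ w, φ w ^ 2 - K ≤ latticePhi4Action J lam φ)
    (δ : ℝ) (k : ℕ) :
    Integrable (fun z : (Fin (n + 1) → ℝ) × (Fin (n + 1) → ℝ) =>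
      (∑ x, ((leapfrogQPQ J lam δ)^[k] z).2 x) ^ 2 * Real.exp (-phi4HmcEnergy J lam z))
      ((volume : Measure (Fin (n + 1) → ℝ)).prod volume) := by
  obtain ⟨C, hC1, hC⟩ := phaseSize_iterate_le J lam δ k
  have hpow : 4 ^ k = (4 ^ k - 1) + 1 := (Nat.sub_add_cancel (Nat.one_le_pow k 4 (by norm_num))).symm
  have hdom := (integrable_phaseSize_pow_mul_exp_neg hε hS (4 ^ k - 1)).const_mul (((n : ℝ) + 1) * C)
  have hLm : Measurable ((leapfrogQPQ J lam δ)^[k]) := (measurable_leapfrogQPQ J lam δ).iterate k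
  have hPm : Measurable fun z : (Fin (n + 1) → ℝ) × (Fin (n + 1) → ℝ) =>
      ∑ x, ((leapfrogQPQ J lam δ)^[k] z).2 x :=
    Finset.measurable_sum _ fun x _ => (measurable_pi_apply x).comp (measurable_snd.comp hLm)
  refine Integrable.mono' hdom ((hPm.pow_const 2).mul
    (Real.measurable_exp.comp (measurable_phi4HmcEnergy J lam).neg)).aestronglyMeasurable
    (Eventually.of_forall fun z => ?_)
  have hw0 : 0 ≤ Real.exp (-phi4HmcEnergy J lam z) := (Real.exp_pos _).le
  rw [Real.norm_eq_abs, abs_mul, abs_of_nonneg (sq_nonneg _), abs_of_nonneg hw0]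
  set z' := (leapfrogQPQ J lam δ)^[k] z with hz'
  have hcs := sq_sum_le_card_mul_sum_sq (s := (Finset.univ : Finset (Fin (n + 1)))) (f := z'.2)
  rw [Finset.card_univ, Fintype.card_fin] at hcs
  push_cast at hcs
  have hV : (0 : ℝ) ≤ (n : ℝ) + 1 := by positivity
  have hs' : ∑ x, z'.2 x ^ 2 ≤ C * phaseSize z ^ (4 ^ k - 1 + 1) := by
    rw [← hpow]
    exact (sum_sq_snd_le_phaseSize z').trans (hC z)
  calc (∑ x, z'.2 x) ^ 2 * Real.exp (-phi4HmcEnergy J lam z)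
      ≤ (((n : ℝ) + 1) * ∑ x, z'.2 x ^ 2) * Real.exp (-phi4HmcEnergy J lam z) :=
        mul_le_mul_of_nonneg_right hcs hw0
    _ ≤ (((n : ℝ) + 1) * (C * phaseSize z ^ (4 ^ k - 1 + 1))) * Real.exp (-phi4HmcEnergy J lam z) :=
        mul_le_mul_of_nonneg_right (mul_le_mul_of_nonneg_left hs' hV) hw0
    _ = ((n : ℝ) + 1) * C * (phaseSize z ^ (4 ^ k - 1 + 1) * Real.exp (-phi4HmcEnergy J lam z)) := by
        ring

/-- Cauchy–Schwarz for a finite sum: `(Σ_{k<N} a_k)² ≤ N Σ_{k<N} a_k²`. -/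
theorem sq_sum_le_mul_sum_sq (N : ℕ) (a : ℕ → ℝ) :
    (∑ k ∈ Finset.range N, a k) ^ 2 ≤ (N : ℝ) * ∑ k ∈ Finset.range N, a k ^ 2 := by
  have h := sq_sum_le_card_mul_sum_sq (s := Finset.range N) (f := a)
  rw [Finset.card_range] at h
  exact h

/-- **THE MEAN SQUARED ACCEPTED JUMP OF THE MAGNETISATION OVER AN `N`-STEP TRAJECTORY, MODULO THE
MOMENTUM PROFILE.**  Coercive action, every `J`, `λ`, `δ`, `N`; `f` with `|f ψ − f φ| ≤ |Σψ − Σφ|`;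
profile bounds `∫∫ P((L^k z).2)² e^{−H} ≤ m_k · V · Z_p Z` for `k ≤ N`.  Then
`∫∫ a (f((Ψ_N z).1) − f(z.1))² e^{−H} ≤ (δ² N V/2) (Σ_{k<N} (m_k + m_{k+1})) · Z_p Z`. -/
theorem hmc_traj_msd_le {J : Fin (n + 1) → Fin (n + 1) → ℝ} {lam ε K : ℝ} (hε : 0 < ε)
    (hS : ∀ φ : Fin (n + 1) → ℝ, ε * ∑ w, φ w ^ 2 - K ≤ latticePhi4Action J lam φ) (δ : ℝ) (N : ℕ)
    {m : ℕ → ℝ}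
    (hm : ∀ k ≤ N, ∫ z : (Fin (n + 1) → ℝ) × (Fin (n + 1) → ℝ),
        (∑ x, ((leapfrogQPQ J lam δ)^[k] z).2 x) ^ 2 * Real.exp (-phi4HmcEnergy J lam z)
          ∂((volume : Measure (Fin (n + 1) → ℝ)).prod volume)
        ≤ m k * (((n : ℝ) + 1) * (momentumZ n * gibbsZ J lam)))
    {f : (Fin (n + 1) → ℝ) → ℝ}
    (hfM : ∀ ψ φ : Fin (n + 1) → ℝ, |f ψ - f φ| ≤ |(∑ x, ψ x) - ∑ x, φ x|) :
    ∫ z, involAccept (phi4HmcEnergy J lam) (hmcProposal J lam δ N) z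
        * (f (hmcProposal J lam δ N z).1 - f z.1) ^ 2 * Real.exp (-phi4HmcEnergy J lam z)
          ∂((volume : Measure (Fin (n + 1) → ℝ)).prod volume)
      ≤ δ ^ 2 * N * ((n : ℝ) + 1) / 2 * (∑ k ∈ Finset.range N, (m k + m (k + 1)))
          * (momentumZ n * gibbsZ J lam) := by
  set H := phi4HmcEnergy J lam with hH
  set Ψ := hmcProposal J lam δ N with hΨ
  set L := leapfrogQPQ J lam δ with hL
  set P : ℕ → (Fin (n + 1) → ℝ) × (Fin (n + 1) → ℝ) → ℝ := fun k z => ∑ x, (L^[k] z).2 x with hP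
  -- the φ-component of the proposal is the endpoint of the trajectory
  have hΨ1 : ∀ z, (Ψ z).1 = (L^[N] z).1 := fun z => by simp [hΨ, hL, hmcProposal, momFlip]
  -- integrable pieces
  have hI : ∀ k, Integrable (fun z => P k z ^ 2 * Real.exp (-H z))
      ((volume : Measure (Fin (n + 1) → ℝ)).prod volume) := fun k =>
    integrable_totalSq_iterate_mul_exp_neg hε hS δ k
  have hIk : ∀ k ∈ Finset.range N, Integrable
      (fun z => P k z ^ 2 * Real.exp (-H z) + P (k + 1) z ^ 2 * Real.exp (-H z))
      ((volume : Measure (Fin (n + 1) → ℝ)).prod volume) := fun k _ => (hI k).add (hI (k + 1))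
  have hR : Integrable (fun z => δ ^ 2 * N / 2
      * ∑ k ∈ Finset.range N, (P k z ^ 2 * Real.exp (-H z) + P (k + 1) z ^ 2 * Real.exp (-H z)))
      ((volume : Measure (Fin (n + 1) → ℝ)).prod volume) :=
    (integrable_finsetSum _ hIk).const_mul _
  -- pointwise: a (Δf)² e^{-H} ≤ (δ²N/2) Σ_k (P_k² + P_{k+1}²) e^{-H}
  have hpt : ∀ z, involAccept H Ψ z * (f (Ψ z).1 - f z.1) ^ 2 * Real.exp (-H z)
      ≤ δ ^ 2 * N / 2
        * ∑ k ∈ Finset.range N, (P k z ^ 2 * Real.exp (-H z) + P (k + 1) z ^ 2 * Real.exp (-H z)) := by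
    intro z
    have ha0 := involAccept_nonneg H Ψ z
    have ha1 := involAccept_le_one H Ψ z
    have hw0 : 0 ≤ Real.exp (-H z) := (Real.exp_pos _).le
    have hpath := sum_fst_leapfrogQPQ_iterate_sub J lam δ z N
    have hf2 : (f (Ψ z).1 - f z.1) ^ 2 ≤ ((∑ x, (L^[N] z).1 x) - ∑ x, z.1 x) ^ 2 := by
      rw [← sq_abs, ← sq_abs ((∑ x, (L^[N] z).1 x) - ∑ x, z.1 x), hΨ1 z]
      exact pow_le_pow_left₀ (abs_nonneg _) (hfM _ _) 2
    have hsum : ((∑ x, (L^[N] z).1 x) - ∑ x, z.1 x) ^ 2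
        ≤ δ ^ 2 * N / 2 * ∑ k ∈ Finset.range N, (P k z ^ 2 + P (k + 1) z ^ 2) := by
      rw [hL, hpath]
      have hcs := sq_sum_le_mul_sum_sq N (fun k => P k z + P (k + 1) z)
      have h2 : ∑ k ∈ Finset.range N, (P k z + P (k + 1) z) ^ 2
          ≤ ∑ k ∈ Finset.range N, 2 * (P k z ^ 2 + P (k + 1) z ^ 2) :=
        Finset.sum_le_sum fun k _ => by nlinarith [sq_nonneg (P k z - P (k + 1) z)]
      rw [← Finset.mul_sum] at h2
      have hN : (0 : ℝ) ≤ N := Nat.cast_nonneg N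
      simp only [hP, hL] at hcs h2 ⊢
      calc (δ / 2 * ∑ k ∈ Finset.range N, ((∑ x, ((leapfrogQPQ J lam δ)^[k] z).2 x)
              + ∑ x, ((leapfrogQPQ J lam δ)^[k + 1] z).2 x)) ^ 2
          = (δ / 2) ^ 2 * (∑ k ∈ Finset.range N, ((∑ x, ((leapfrogQPQ J lam δ)^[k] z).2 x)
              + ∑ x, ((leapfrogQPQ J lam δ)^[k + 1] z).2 x)) ^ 2 := by ring
        _ ≤ (δ / 2) ^ 2 * ((N : ℝ) * (2 * ∑ k ∈ Finset.range N,
              ((∑ x, ((leapfrogQPQ J lam δ)^[k] z).2 x) ^ 2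
                + (∑ x, ((leapfrogQPQ J lam δ)^[k + 1] z).2 x) ^ 2))) :=
            mul_le_mul_of_nonneg_left (hcs.trans (mul_le_mul_of_nonneg_left h2 hN)) (sq_nonneg _)
        _ = _ := by ring
    have h1 : involAccept H Ψ z * (f (Ψ z).1 - f z.1) ^ 2
        ≤ 1 * (δ ^ 2 * N / 2 * ∑ k ∈ Finset.range N, (P k z ^ 2 + P (k + 1) z ^ 2)) :=
      mul_le_mul ha1 (hf2.trans hsum) (sq_nonneg _) zero_le_one
    rw [one_mul] at h1
    have h3 := mul_le_mul_of_nonneg_right h1 hw0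
    calc _ ≤ δ ^ 2 * N / 2 * (∑ k ∈ Finset.range N, (P k z ^ 2 + P (k + 1) z ^ 2)) * Real.exp (-H z) := h3
      _ = _ := by rw [mul_assoc, Finset.sum_mul]; congr 1; exact Finset.sum_congr rfl fun k _ => by ring
  have hmono := integral_mono_of_nonneg (μ := ((volume : Measure (Fin (n + 1) → ℝ)).prod volume))
    (Eventually.of_forall fun z =>
      mul_nonneg (mul_nonneg (involAccept_nonneg H Ψ z) (sq_nonneg _)) (Real.exp_pos _).le)
    hR (Eventually.of_forall hpt)
  rw [integral_const_mul, integral_finsetSum _ hIk] at hmono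
  have hsplit : ∀ k, ∫ z, (P k z ^ 2 * Real.exp (-H z) + P (k + 1) z ^ 2 * Real.exp (-H z))
      ∂((volume : Measure (Fin (n + 1) → ℝ)).prod volume)
      = (∫ z, P k z ^ 2 * Real.exp (-H z) ∂((volume : Measure (Fin (n + 1) → ℝ)).prod volume))
        + ∫ z, P (k + 1) z ^ 2 * Real.exp (-H z) ∂((volume : Measure (Fin (n + 1) → ℝ)).prod volume) :=
    fun k => integral_add (hI k) (hI (k + 1))
  simp_rw [hsplit] at hmono
  have hbound : ∑ k ∈ Finset.range N,
      ((∫ z, P k z ^ 2 * Real.exp (-H z) ∂((volume : Measure (Fin (n + 1) → ℝ)).prod volume))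
        + ∫ z, P (k + 1) z ^ 2 * Real.exp (-H z) ∂((volume : Measure (Fin (n + 1) → ℝ)).prod volume))
      ≤ ∑ k ∈ Finset.range N, (m k + m (k + 1)) * (((n : ℝ) + 1) * (momentumZ n * gibbsZ J lam)) := by
    refine Finset.sum_le_sum fun k hk => ?_
    have hkN : k < N := Finset.mem_range.mp hk
    have h1 := hm k hkN.le
    have h2 := hm (k + 1) hkN
    simp only [hP, hL] at h1 h2 ⊢
    linarith
  rw [← Finset.sum_mul] at hbound
  have hc : 0 ≤ δ ^ 2 * N / 2 := by positivity
  calc _ ≤ δ ^ 2 * ↑N / 2 * ∑ k ∈ Finset.range N,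
        ((∫ z, P k z ^ 2 * Real.exp (-H z) ∂((volume : Measure (Fin (n + 1) → ℝ)).prod volume))
          + ∫ z, P (k + 1) z ^ 2 * Real.exp (-H z) ∂((volume : Measure (Fin (n + 1) → ℝ)).prod volume)) :=
        hmono
    _ ≤ δ ^ 2 * N / 2 * ((∑ k ∈ Finset.range N, (m k + m (k + 1)))
        * (((n : ℝ) + 1) * (momentumZ n * gibbsZ J lam))) := mul_le_mul_of_nonneg_left hbound hc
    _ = _ := by ring

/-- **THE N-STEP HMC FLOOR MODULO THE MOMENTUM PROFILE.**  Lattice φ⁴, every `λ > 0`, real `J`,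
step size `δ`, trajectory length `N` (qpq); profile bounds `∫∫ P((L^k z).2)² e^{−H} ≤ m_k V Z_p Z`
for `k ≤ N`; `f` bounded measurable with `|f ψ − f φ| ≤ |Σψ − Σφ|`, `g = f − ⟨f⟩`.  Summable
autocorrelations with `ρ_g(1) < 1` ⇒
`τ_int,traj(f) ≥ 2 ⟨(f − ⟨f⟩)²⟩ / ((δ² N (n+1)/2) Σ_{k<N} (m_k + m_{k+1})) − ½`. -/
theorem hmcPhi4_traj_tauInt_ge {lam : ℝ} (hlam : 0 < lam) (J : Fin (n + 1) → Fin (n + 1) → ℝ)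
    (δ : ℝ) (N : ℕ) {m : ℕ → ℝ}
    (hm : ∀ k ≤ N, ∫ z : (Fin (n + 1) → ℝ) × (Fin (n + 1) → ℝ),
        (∑ x, ((leapfrogQPQ J lam δ)^[k] z).2 x) ^ 2 * Real.exp (-phi4HmcEnergy J lam z)
          ∂((volume : Measure (Fin (n + 1) → ℝ)).prod volume)
        ≤ m k * (((n : ℝ) + 1) * (momentumZ n * gibbsZ J lam)))
    {f : (Fin (n + 1) → ℝ) → ℝ} (hf : BddObs f)
    (hfM : ∀ ψ φ : Fin (n + 1) → ℝ, |f ψ - f φ| ≤ |(∑ x, ψ x) - ∑ x, φ x|)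
    (hs : Summable fun k => (∫ φ, (f φ - gibbsExpect J lam f)
        * ((hmcOpPhi4 J lam δ N)^[k + 1] (fun ψ => f ψ - gibbsExpect J lam f)) φ * gibbsWeight J lam φ)
        / ∫ φ, (f φ - gibbsExpect J lam f) ^ 2 * gibbsWeight J lam φ)
    (hρ : (∫ φ, (f φ - gibbsExpect J lam f)
        * hmcOpPhi4 J lam δ N (fun ψ => f ψ - gibbsExpect J lam f) φ * gibbsWeight J lam φ)
        / (∫ φ, (f φ - gibbsExpect J lam f) ^ 2 * gibbsWeight J lam φ) < 1) :
    2 * gibbsExpect J lam (fun φ => (f φ - gibbsExpect J lam f) ^ 2)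
        / (δ ^ 2 * N * ((n : ℝ) + 1) / 2 * ∑ k ∈ Finset.range N, (m k + m (k + 1))) - 1 / 2
      ≤ tauInt (fun k => (∫ φ, (f φ - gibbsExpect J lam f)
          * ((hmcOpPhi4 J lam δ N)^[k] (fun ψ => f ψ - gibbsExpect J lam f)) φ * gibbsWeight J lam φ)
          / ∫ φ, (f φ - gibbsExpect J lam f) ^ 2 * gibbsWeight J lam φ) :=
  hmcPhi4_tauInt_ge_of_msd_le hlam J δ N hf
    (hmc_traj_msd_le one_pos (latticePhi4Action_coercive hlam J) δ N hm hfM) hs hρ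

/-- **UNIFORM PROFILE: `τ_int,traj(f) ≥ 2 Var(f)/(V T² m̄) − ½`, `T = Nδ`.**  If the momentum
profile is uniformly bounded along the trajectory, `∫∫ P((L^k z).2)² e^{−H} ≤ m̄ V Z_p Z` for all
`k ≤ N` (`m̄ = 1` for any `e^{−H}`-preserving integrator), then for every bounded
measurable `f` that is 1-Lipschitz in `M`:
`τ_int,traj(f) ≥ 2 ⟨(f − ⟨f⟩)²⟩ / ((n+1) (Nδ)² m̄) − ½`. -/
theorem hmcPhi4_traj_tauInt_ge_uniform {lam : ℝ} (hlam : 0 < lam) (J : Fin (n + 1) → Fin (n + 1) → ℝ)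
    (δ : ℝ) (N : ℕ) {mbar : ℝ}
    (hm : ∀ k ≤ N, ∫ z : (Fin (n + 1) → ℝ) × (Fin (n + 1) → ℝ),
        (∑ x, ((leapfrogQPQ J lam δ)^[k] z).2 x) ^ 2 * Real.exp (-phi4HmcEnergy J lam z)
          ∂((volume : Measure (Fin (n + 1) → ℝ)).prod volume)
        ≤ mbar * (((n : ℝ) + 1) * (momentumZ n * gibbsZ J lam)))
    {f : (Fin (n + 1) → ℝ) → ℝ} (hf : BddObs f)
    (hfM : ∀ ψ φ : Fin (n + 1) → ℝ, |f ψ - f φ| ≤ |(∑ x, ψ x) - ∑ x, φ x|)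
    (hs : Summable fun k => (∫ φ, (f φ - gibbsExpect J lam f)
        * ((hmcOpPhi4 J lam δ N)^[k + 1] (fun ψ => f ψ - gibbsExpect J lam f)) φ * gibbsWeight J lam φ)
        / ∫ φ, (f φ - gibbsExpect J lam f) ^ 2 * gibbsWeight J lam φ)
    (hρ : (∫ φ, (f φ - gibbsExpect J lam f)
        * hmcOpPhi4 J lam δ N (fun ψ => f ψ - gibbsExpect J lam f) φ * gibbsWeight J lam φ)
        / (∫ φ, (f φ - gibbsExpect J lam f) ^ 2 * gibbsWeight J lam φ) < 1) :
    2 * gibbsExpect J lam (fun φ => (f φ - gibbsExpect J lam f) ^ 2)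
        / (((n : ℝ) + 1) * ((N : ℝ) * δ) ^ 2 * mbar) - 1 / 2
      ≤ tauInt (fun k => (∫ φ, (f φ - gibbsExpect J lam f)
          * ((hmcOpPhi4 J lam δ N)^[k] (fun ψ => f ψ - gibbsExpect J lam f)) φ * gibbsWeight J lam φ)
          / ∫ φ, (f φ - gibbsExpect J lam f) ^ 2 * gibbsWeight J lam φ) := by
  -- the uniform profile gives the msd bound with D = V (Nδ)² m̄
  have hmsd := hmc_traj_msd_le one_pos (latticePhi4Action_coercive hlam J) δ N
    (m := fun _ => mbar) (fun k hk => hm k hk) hfM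
  have hZ := gibbsZ_pos hlam J
  have hZp := momentumZ_pos n
  have hm0 : 0 ≤ mbar := by
    have h0 := hm 0 (Nat.zero_le N)
    have hI0 : 0 ≤ ∫ z : (Fin (n + 1) → ℝ) × (Fin (n + 1) → ℝ),
        (∑ x, ((leapfrogQPQ J lam δ)^[0] z).2 x) ^ 2 * Real.exp (-phi4HmcEnergy J lam z)
          ∂((volume : Measure (Fin (n + 1) → ℝ)).prod volume) :=
      integral_nonneg fun z => mul_nonneg (sq_nonneg _) (Real.exp_pos _).le
    have hpos : 0 < ((n : ℝ) + 1) * (momentumZ n * gibbsZ J lam) := by positivity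
    nlinarith
  have e : δ ^ 2 * N * ((n : ℝ) + 1) / 2 * (∑ k ∈ Finset.range N, (mbar + mbar))
      = ((n : ℝ) + 1) * ((N : ℝ) * δ) ^ 2 * mbar := by
    rw [Finset.sum_const, Finset.card_range, nsmul_eq_mul]
    ring
  have hD : ∫ z, involAccept (phi4HmcEnergy J lam) (hmcProposal J lam δ N) z
        * (f (hmcProposal J lam δ N z).1 - f z.1) ^ 2 * Real.exp (-phi4HmcEnergy J lam z)
          ∂((volume : Measure (Fin (n + 1) → ℝ)).prod volume)
      ≤ ((n : ℝ) + 1) * ((N : ℝ) * δ) ^ 2 * mbar * (momentumZ n * gibbsZ J lam) := by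
    rw [← e]; exact hmsd
  exact hmcPhi4_tauInt_ge_of_msd_le hlam J δ N hf hD hs hρ

end Trajectory

end Summit.Ventures.LatticeQCDFlow.Exactness
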